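import Summits.BirchSwinnertonDyer.Rank1Residual.Partition.EisensteinKernelReductionLineMult
import HarnessLib

/-!
# The Greenberg–Vatsal type at a MULTIPLICATIVE odd `p`, without the Tate curve: type-independence,
# isogeny invariance, CASE 2 ⇒ CASE 1, and the decision `GVPar W p ↔ (1 < v_𝔓(x) ↔ 0 < Ψ₂Sq(r))`

HONEST FRAMING (cell `b2b-bsdres-*`, verbatim): the goal of the cell is to DELETE the
COMBINATION-SHAPED residual classes for ALL analytic-rank ≤ 1 curves over ℚ — "full BSD formula
for every rank ≤ 1 curve in class C" assembled STRICTLY from published theorems — so that the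
rank-≤1 remainder becomes exactly the CONSTRUCTION-SHAPED classes, which are TYPED (missing-input
Props), NOT attempted; this is not "finishing BSD". Off-peak literature typer `b2b-bsdres-lit-cgls`
(CGLS22 / GV00, the reducible = Eisenstein column), session 15, file 3 of 3: an ELEMENTARY REDUCTION
of the Eisenstein column at every MULTIPLICATIVE odd prime (class X2 / the O9, N9 sub-cells) —
theorems only, no definition, no named fact, nothing booked, no label changed.

WHY. Greenberg–Vatsal's hypothesis (Invent. Math. 142 (2000), Thm. (1.3)) asks for a rational
`p`-isogeny kernel `Φ` which is (ramified at `p` ∧ even) or (unramified at `p` ∧ odd); the lane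
decides it per pair by T-GV0 (kernel polynomial `p`-integral or not; sign of `Ψ₂Sq` on its real
roots). Session 14 turned both steps into theorems about ONE rational line at a good ordinary odd `p`
(`gvPar_iff_valuation_iff_aeval_real_pos`); at a MULTIPLICATIVE odd `p` the existing bookkeeping
(`X2.gvType_iff_of_isRationalLine_of_mult`, `X2.gvPar_iff_of_isIsogenous_of_mult`,
`X2.IsogenyLineType.exists_rationalLine_ramified_even_of_isogeny`, lit-cgls s9–s13) was granted the
Tate-uniformisation named facts `hT`, `hT'` (A40/A41) for the Tate line. With file 1's Tate-free
inertia line (`exists_inertiaLine_of_mult`) and file 2's criterion, all of it holds WITHOUT `hT`/`hT'`: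

* §4 `gvType_iff_of_isRationalLine_of_hasMultiplicativeReduction` (the type of a rational line does not
  depend on the line), `not_gvPar_of_isRationalLine_of_hasMultiplicativeReduction`,
  `gvType_iff_gvPar_of_mult`, `gvPar_iff_of_isIsogenous_of_hasMultiplicativeReduction` (isogeny-class
  invariance), `exists_rationalLine_ramified_even_of_isogeny_of_mult` (GV p. 28: CASE 2 for `E` ⇒
  CASE 1 for `E/Φ₀`) — x1a's generic transfer theorems fed with the Tate-free (hL);
* the DECISION from one kernel point: **`gvPar_iff_valuation_iff_aeval_real_pos_of_mult`**
  (`GVPar W p ↔ (1 < v_𝔓(x) ↔ 0 < Ψ₂Sq(r))`, `r` the real abscissa), its complex form, the co-type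
  table `not_gvPar_iff_valuation_iff_aeval_real_neg_of_mult`, and the four certificate forms
  (integrality certificate × real-root sign certificate ⇒ type B / type A) used by per-pair records.

References: R. Greenberg, V. Vatsal, Invent. Math. 142 (2000), Thm. (1.3), §2 p. 28
[GreenbergVatsal2000]; J.-P. Serre, Invent. Math. 15 (1972) §1.11–1.12 [SerreInventiones1972];
J. H. Silverman, *AEC*, GTM 106 (2009), VII.2.1 [SilvermanAEC2009]; bsdN/HYPOTHESES.md row T-GV0;
HOME/b2b-bsdres-lit-cgls/CGLS-GV-TYPING.md §22.
-/

set_option autoImplicit false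

noncomputable section

open scoped Classical NumberField ComplexConjugate

open WeierstrassCurve Polynomial Literature.NumberTheory.EllipticCurves
  Literature.NumberTheory.EllipticCurves.Rank1Residual Literature.NumberTheory.GaloisRepresentations
  Field IsDedekindDomain NumberField Rat.HeightOneSpectrum

namespace Summit.BirchSwinnertonDyer.Rank1Residual

namespace KernelDisc

variable {W : WeierstrassCurve ℚ} [W.IsElliptic] [W.IsGloballyMinimal] {p : ℕ} [Fact p.Prime]
  {Φ : AddSubgroup (geomTorsion W (p : ℤ))}
/-! ### §4. The Greenberg–Vatsal type at a multiplicative odd `p`, without the Tate curve -/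

section GVType

/-- **The Greenberg–Vatsal type of a rational `p`-isogeny kernel does not depend on the kernel at an
odd MULTIPLICATIVE prime — Tate-free** (globally minimal `W`): for rational lines `Φ₁, Φ₂ ≤ E[p]`,
`Φ₁` is (ramified ∧ even) ∨ (unramified ∧ odd) iff `Φ₂` is. x1a's
`gvType_of_isRationalLine_of_ordinaryLine` with (hL) = §2's inertia line and (hc) = the Weil-pairing
signs; the `hT`/`hT'`-free twin of `X2.gvType_iff_of_isRationalLine_of_mult`.
[cite: GreenbergVatsal2000, Thm. (1.3) and §2 p. 28] [cite: SerreInventiones1972, §1.12] -/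
theorem gvType_iff_of_isRationalLine_of_hasMultiplicativeReduction (hp2 : p ≠ 2)
    (hmult : W.HasMultiplicativeReductionAtPrime p)
    {Φ₁ Φ₂ : AddSubgroup (geomTorsion W (p : ℤ))} (hΦ₁ : IsRationalLine W p Φ₁)
    (hΦ₂ : IsRationalLine W p Φ₂) :
    ((¬ LineUnramifiedAt W p Φ₁ ∧ LineEven W p Φ₁) ∨ (LineUnramifiedAt W p Φ₁ ∧ LineOdd W p Φ₁)) ↔
      ((¬ LineUnramifiedAt W p Φ₂ ∧ LineEven W p Φ₂) ∨ (LineUnramifiedAt W p Φ₂ ∧ LineOdd W p Φ₂)) :=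
  ⟨gvType_of_isRationalLine_of_ordinaryLine hp2 (Rank1Residual.natCard_geomTorsion W p)
      (exists_inertiaLine_of_mult W p hp2 hmult)
      (exists_fixed_and_antifixed_of_isComplexConjugation W hp2) hΦ₁ hΦ₂,
    gvType_of_isRationalLine_of_ordinaryLine hp2 (Rank1Residual.natCard_geomTorsion W p)
      (exists_inertiaLine_of_mult W p hp2 hmult)
      (exists_fixed_and_antifixed_of_isComplexConjugation W hp2) hΦ₂ hΦ₁⟩

/-- **One rational line of co-type makes the curve of type A at an odd multiplicative prime —
Tate-free**: if some rational line `Φ ≤ E[p]` is NOT of Greenberg–Vatsal type then `¬ GVPar W p`.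
The `hT`/`hT'`-free twin of `X2.not_gvPar_of_isRationalLine_of_mult`.
[cite: GreenbergVatsal2000, Thm. (1.3) and §2 p. 28] -/
theorem not_gvPar_of_isRationalLine_of_hasMultiplicativeReduction (hp2 : p ≠ 2)
    (hmult : W.HasMultiplicativeReductionAtPrime p) (hΦ : IsRationalLine W p Φ)
    (h : ¬ ((¬ LineUnramifiedAt W p Φ ∧ LineEven W p Φ) ∨ (LineUnramifiedAt W p Φ ∧ LineOdd W p Φ))) :
    ¬ GVPar W p := by
  rintro ⟨Ψ, hΨ, hQ⟩
  exact h ((gvType_iff_of_isRationalLine_of_hasMultiplicativeReduction hp2 hmult hΨ hΦ).mp hQ)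

/-- **`GVPar` is the type of ANY rational line** (multiplicative odd `p`, Tate-free): `GVPar W p` iff
`Φ` is (ramified ∧ even) ∨ (unramified ∧ odd). The multiplicative twin of `gvType_iff_gvPar_of_goodOrd`.
[cite: GreenbergVatsal2000, Thm. (1.3)] -/
theorem gvType_iff_gvPar_of_mult (hΦ : IsRationalLine W p Φ) (hp2 : p ≠ 2)
    (hmult : W.HasMultiplicativeReductionAtPrime p) :
    ((¬ LineUnramifiedAt W p Φ ∧ LineEven W p Φ) ∨ (LineUnramifiedAt W p Φ ∧ LineOdd W p Φ)) ↔
      GVPar W p :=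
  ⟨fun h ↦ ⟨Φ, hΦ, h⟩, fun hB ↦ by
    by_contra h
    exact not_gvPar_of_isRationalLine_of_hasMultiplicativeReduction hp2 hmult hΦ h hB⟩

variable {W' : WeierstrassCurve ℚ} [W'.IsElliptic] [W'.IsGloballyMinimal]

/-- **`GVPar` is a function of the `ℚ`-isogeny class at an odd multiplicative prime — Tate-free.** For
globally minimal `W, W'` over `ℚ`, `p ≠ 2` a prime of multiplicative reduction of `W`, and
`IsIsogenous W W'`: `GVPar W p ↔ GVPar W' p`. x1a's `gvPar_iff_of_isogeny_of_ordinaryLine` with the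
(hL) of both curves from §2 (`W'` is multiplicative at `p` too,
`X2.IsogenyQuotientLine.hasMultiplicativeReductionAtPrime_of_isIsogenous`); the `hT`/`hT'`-free twin
of `X2.gvPar_iff_of_isIsogenous_of_mult`. [cite: GreenbergVatsal2000, Thm. (1.3) and §2 p. 28] -/
theorem gvPar_iff_of_isIsogenous_of_hasMultiplicativeReduction (hp2 : p ≠ 2)
    (hmult : W.HasMultiplicativeReductionAtPrime p) (hW : IsIsogenous W W') :
    GVPar W p ↔ GVPar W' p := by
  have hmult' : W'.HasMultiplicativeReductionAtPrime p :=
    X2.IsogenyQuotientLine.hasMultiplicativeReductionAtPrime_of_isIsogenous hW hmult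
  obtain ⟨f, P, hP, hf⟩ := exists_isogeny_apply_ne_zero (p := p) hW
  obtain ⟨f', P', hP', hf'⟩ := exists_isogeny_apply_ne_zero (p := p) hW.symm_of_charZero
  exact gvPar_iff_of_isogeny_of_ordinaryLine hp2 (exists_inertiaLine_of_mult W p hp2 hmult)
    (exists_inertiaLine_of_mult W' p hp2 hmult') f ⟨P, hP, hf⟩ f' ⟨P', hP', hf'⟩

omit [W'.IsElliptic] [W'.IsGloballyMinimal] in
/-- **GV CASE 2 for `E` ⟹ CASE 1 for `E' = E/Φ₀` — Tate-free.** Let `E/ℚ` be globally minimal with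
multiplicative reduction at the odd prime `p`, `Φ₀ ≤ E[p]` a rational line UNRAMIFIED at `p` and ODD,
and `f : E → E'` a `ℚ`-isogeny whose kernel on `ℚ̄`-points is `Φ₀`. Then `E'[p]` contains a rational
line (namely `f(E[p]) ≅ E[p]/Φ₀`) which is RAMIFIED at `p` and EVEN. The argument of
`X2.IsogenyLineType.exists_rationalLine_ramified_even_of_isogeny` (GV p. 28) with its Tate line
replaced by §2's inertia line. [cite: GreenbergVatsal2000, §2 p. 28 (reduction to φ ramified and even)] -/
theorem exists_rationalLine_ramified_even_of_isogeny_of_mult (hp2 : p ≠ 2)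
    (hmult : W.HasMultiplicativeReductionAtPrime p)
    {Φ₀ : AddSubgroup (geomTorsion W (p : ℤ))} (hΦ : IsRationalLine W p Φ₀)
    (hu : LineUnramifiedAt W p Φ₀) (ho : LineOdd W p Φ₀)
    (f : Isogeny W W') (hker : f.toAddMonoidHom.ker = Φ₀.map (geomTorsion W (p : ℤ)).subtype) :
    ∃ Φ' : AddSubgroup (geomTorsion W' (p : ℤ)),
      IsRationalLine W' p Φ' ∧ ¬ LineUnramifiedAt W' p Φ' ∧ LineEven W' p Φ' := by
  have hp : p.Prime := Fact.out
  obtain ⟨g, hgval, hg⟩ := X2.IsogenyLineType.exists_restrict_torsion (p := p) f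
  -- `ker g = Φ₀`
  have hK : g.ker = Φ₀ := by
    ext P
    rw [AddMonoidHom.mem_ker]
    constructor
    · intro hP
      have h1 : (P : geomPoints W) ∈ f.toAddMonoidHom.ker := by
        rw [AddMonoidHom.mem_ker, Isogeny.coe_toAddMonoidHom, ← hgval, hP]; rfl
      rw [hker] at h1
      obtain ⟨Q, hQ, hQP⟩ := h1
      have : Q = P := Subtype.ext hQP
      exact this ▸ hQ
    · intro hP
      have h1 : (P : geomPoints W) ∈ f.toAddMonoidHom.ker := by
        rw [hker]; exact ⟨P, hP, rfl⟩
      rw [AddMonoidHom.mem_ker, Isogeny.coe_toAddMonoidHom, ← hgval] at h1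
      exact Subtype.ext h1
  have hKcard : Nat.card g.ker = p := by rw [hK]; exact hΦ.1
  -- (hL₀) at one prime above `p`, Tate-free
  obtain ⟨v, hv⟩ :=
    Literature.NumberTheory.NumberFields.RingOfIntegers.exists_heightOneSpectrum_natCast_mem ℚ hp
  obtain ⟨𝔓, h𝔓⟩ := HeightOneSpectrum.primesAbove_nonempty v
  have hL₀ : ∃ (v : HeightOneSpectrum (𝓞 ℚ)), (p : 𝓞 ℚ) ∈ v.asIdeal ∧ ∃ 𝔓 ∈ v.primesAbove,
      ∃ L : AddSubgroup (geomTorsion W (p : ℤ)), Nat.card L = p ∧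
        (∀ σ ∈ 𝔓.inertia (absoluteGaloisGroup ℚ), ∀ P : geomTorsion W (p : ℤ), σ • P - P ∈ L) ∧
        (∃ σ ∈ 𝔓.inertia (absoluteGaloisGroup ℚ), ∃ P ∈ L, σ • P ≠ P) :=
    ⟨v, hv, 𝔓, h𝔓, exists_inertiaLine_of_mult W p hp2 hmult v hv 𝔓 h𝔓⟩
  obtain ⟨hline, hram, heven⟩ := X2.IsogenyLineType.isRationalLine_range_and_ramified_even_of_ker g hg
    hp2 (Rank1Residual.natCard_geomTorsion W p) hL₀
    (exists_fixed_and_antifixed_of_isComplexConjugation W hp2) hKcard (hK ▸ hu) (hK ▸ ho)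
  exact ⟨g.range, hline, hram, heven⟩

end GVType

/-! #### The decision from one kernel point (multiplicative odd `p`) -/

section Decision

/-- **The Greenberg–Vatsal type decided from one kernel point at a MULTIPLICATIVE odd `p`** (Tate-free).
Let `E/ℚ` be given by a globally minimal `W` with multiplicative reduction at the odd prime `p`,
`Φ ≤ E[p]` ANY rational line, `P = (x, y) ∈ Φ` non-zero, `c` a complex conjugation with embedding
`ι : ℚ̄ → ℂ`. Then `GVPar W p ↔ (1 < v_𝔓(x) ↔ 0 < Re ι(Ψ₂Sq(x)))`: type B iff the abscissa is
non-`𝔓`-integral exactly when the point is real. The multiplicative twin of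
`gvPar_iff_valuation_iff_re_pos`. [cite: GreenbergVatsal2000, Thm. (1.3)] -/
theorem gvPar_iff_valuation_iff_re_pos_of_mult (hΦ : IsRationalLine W p Φ) (hp2 : p ≠ 2)
    (hmult : W.HasMultiplicativeReductionAtPrime p)
    {P : geomTorsion W (p : ℤ)} (hPΦ : P ∈ Φ) (hP0 : P ≠ 0)
    {x y : AlgebraicClosure ℚ} {h : (W.baseChange (AlgebraicClosure ℚ)).toAffine.Nonsingular x y}
    (hP : (P : W.geomPoints) = Affine.Point.some x y h)
    {c : absoluteGaloisGroup ℚ} (hc : IsComplexConjugation (Rat.castHom ℝ) c)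
    {ι : AlgebraicClosure ℚ →+* ℂ} (hι : ∀ z, ι (c • z) = conj (ι z)) :
    GVPar W p ↔ (1 < (placeOver p).valuation x ↔ 0 < (ι (aeval x W.Ψ₂Sq)).re) := by
  rw [← gvType_iff_gvPar_of_mult hΦ hp2 hmult,
    not_lineUnramifiedAt_iff_one_lt_valuation_of_mult hΦ hp2 hmult hPΦ hP,
    lineUnramifiedAt_iff_valuation_le_one_of_mult hΦ hp2 hmult hPΦ hP,
    lineEven_iff_re_pos hΦ hp2 hPΦ hP0 hP hc hι, lineOdd_iff_re_neg hΦ hp2 hPΦ hP0 hP hc hι]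
  -- `Re ι(Ψ₂Sq(x)) ≠ 0`: it is `> 0` or `< 0` according to the parity of `Φ`
  have hne : (ι (aeval x W.Ψ₂Sq)).re ≠ 0 := by
    rcases lineEven_or_lineOdd hΦ with he | ho
    · exact (re_pos_of_lineEven hΦ hp2 hPΦ hP0 hP hc hι he).1.ne'
    · exact (re_neg_of_lineOdd hΦ hp2 hPΦ hP0 hP hc hι ho).1.ne
  constructor
  · rintro (⟨hv, hs⟩ | ⟨hv, hs⟩)
    · exact ⟨fun _ ↦ hs, fun _ ↦ hv⟩
    · exact ⟨fun hv' ↦ absurd hv (not_le.mpr hv'), fun hs' ↦ absurd hs (not_lt.mpr hs'.le)⟩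
  · intro hiff
    by_cases hv : 1 < (placeOver p).valuation x
    · exact Or.inl ⟨hv, hiff.mp hv⟩
    · refine Or.inr ⟨not_lt.mp hv, ?_⟩
      rcases lt_trichotomy ((ι (aeval x W.Ψ₂Sq)).re) 0 with hlt | heq | hgt
      · exact hlt
      · exact absurd heq hne
      · exact absurd (hiff.mpr hgt) hv

/-- **Real-root form** (multiplicative odd `p`): with `ι x = r ∈ ℝ` (`exists_abscissa_eq_ofReal`),
`GVPar W p ↔ (1 < v_𝔓(x) ↔ 0 < Ψ₂Sq(r))`, the value computed in `ℝ` — T-GV0's decision procedure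
("ramified ⇔ `H` not `p`-integral; parity = sign of `Ψ₂Sq` on the roots of `H`") as a theorem at a
multiplicative odd prime. [cite: GreenbergVatsal2000, Thm. (1.3)] -/
theorem gvPar_iff_valuation_iff_aeval_real_pos_of_mult (hΦ : IsRationalLine W p Φ) (hp2 : p ≠ 2)
    (hmult : W.HasMultiplicativeReductionAtPrime p)
    {P : geomTorsion W (p : ℤ)} (hPΦ : P ∈ Φ) (hP0 : P ≠ 0)
    {x y : AlgebraicClosure ℚ} {h : (W.baseChange (AlgebraicClosure ℚ)).toAffine.Nonsingular x y}
    (hP : (P : W.geomPoints) = Affine.Point.some x y h)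
    {c : absoluteGaloisGroup ℚ} (hc : IsComplexConjugation (Rat.castHom ℝ) c)
    {ι : AlgebraicClosure ℚ →+* ℂ} (hι : ∀ z, ι (c • z) = conj (ι z)) {r : ℝ} (hr : ι x = r) :
    GVPar W p ↔ (1 < (placeOver p).valuation x ↔ 0 < aeval r W.Ψ₂Sq) := by
  rw [gvPar_iff_valuation_iff_re_pos_of_mult hΦ hp2 hmult hPΦ hP0 hP hc hι, map_aeval_eq, hr,
    eval₂_ofReal_eq, Complex.ofReal_re]

/-- **The four-way table, co-type side** (multiplicative odd `p`): `¬ GVPar W p ↔ (1 < v_𝔓(x) ↔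
Ψ₂Sq(r) < 0)` — type A iff the abscissa is non-integral exactly when the point is non-real.
[cite: GreenbergVatsal2000, Thm. (1.3)] -/
theorem not_gvPar_iff_valuation_iff_aeval_real_neg_of_mult (hΦ : IsRationalLine W p Φ) (hp2 : p ≠ 2)
    (hmult : W.HasMultiplicativeReductionAtPrime p)
    {P : geomTorsion W (p : ℤ)} (hPΦ : P ∈ Φ) (hP0 : P ≠ 0)
    {x y : AlgebraicClosure ℚ} {h : (W.baseChange (AlgebraicClosure ℚ)).toAffine.Nonsingular x y}
    (hP : (P : W.geomPoints) = Affine.Point.some x y h)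
    {c : absoluteGaloisGroup ℚ} (hc : IsComplexConjugation (Rat.castHom ℝ) c)
    {ι : AlgebraicClosure ℚ →+* ℂ} (hι : ∀ z, ι (c • z) = conj (ι z)) {r : ℝ} (hr : ι x = r) :
    ¬ GVPar W p ↔ (1 < (placeOver p).valuation x ↔ aeval r W.Ψ₂Sq < 0) := by
  rw [gvPar_iff_valuation_iff_aeval_real_pos_of_mult hΦ hp2 hmult hPΦ hP0 hP hc hι hr]
  -- `Ψ₂Sq(r) ≠ 0`
  have hne : aeval r W.Ψ₂Sq ≠ 0 := by
    rcases lineEven_or_lineOdd hΦ with he | ho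
    · exact ((lineEven_iff_aeval_real_pos hΦ hp2 hPΦ hP0 hP hc hι hr).mp he).ne'
    · exact ((lineOdd_iff_aeval_real_neg hΦ hp2 hPΦ hP0 hP hc hι hr).mp ho).ne
  rcases lt_or_gt_of_ne hne with hlt | hgt
  · simp only [hlt, not_lt.mpr hlt.le, iff_false, iff_true, not_not]
  · simp only [hgt, not_lt.mpr hgt.le, iff_true, iff_false]

/-- **GV type (ramified ∧ even) from the two certificates** (multiplicative odd `p`): `v_𝔓(x) > 1`
and `Ψ₂Sq > 0` at every real root of an `F ∈ ℚ[X]` vanishing at the abscissa (e.g. `F` = the kernel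
polynomial) give a RAMIFIED EVEN line, so `GVPar W p`. [folklore] -/
theorem gvPar_of_one_lt_valuation_of_forall_real_root_pos_of_mult (hΦ : IsRationalLine W p Φ)
    (hp2 : p ≠ 2) (hmult : W.HasMultiplicativeReductionAtPrime p)
    {P : geomTorsion W (p : ℤ)} (hPΦ : P ∈ Φ) (hP0 : P ≠ 0)
    {x y : AlgebraicClosure ℚ} {h : (W.baseChange (AlgebraicClosure ℚ)).toAffine.Nonsingular x y}
    (hP : (P : W.geomPoints) = Affine.Point.some x y h) (hx : 1 < (placeOver p).valuation x)
    {F : ℚ[X]} (hF : aeval x F = 0) (hpos : ∀ r : ℝ, aeval r F = 0 → 0 < aeval r W.Ψ₂Sq) :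
    GVPar W p :=
  ⟨Φ, hΦ, Or.inl ⟨(not_lineUnramifiedAt_iff_one_lt_valuation_of_mult hΦ hp2 hmult hPΦ hP).mpr hx,
    lineEven_of_forall_real_root_pos hΦ hp2 hPΦ hP0 hP hF hpos⟩⟩

/-- **GV type (unramified ∧ odd) from the two certificates** (multiplicative odd `p`): `v_𝔓(x) ≤ 1`
and `Ψ₂Sq < 0` at every real root of an `F ∈ ℚ[X]` vanishing at `x` give an UNRAMIFIED ODD line, so
`GVPar W p` — the shape of the KDISC-ODD rows of type B on O9 (unramified ∧ odd). [folklore] -/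
theorem gvPar_of_valuation_le_one_of_forall_real_root_neg_of_mult (hΦ : IsRationalLine W p Φ)
    (hp2 : p ≠ 2) (hmult : W.HasMultiplicativeReductionAtPrime p)
    {P : geomTorsion W (p : ℤ)} (hPΦ : P ∈ Φ) (hP0 : P ≠ 0)
    {x y : AlgebraicClosure ℚ} {h : (W.baseChange (AlgebraicClosure ℚ)).toAffine.Nonsingular x y}
    (hP : (P : W.geomPoints) = Affine.Point.some x y h) (hx : (placeOver p).valuation x ≤ 1)
    {F : ℚ[X]} (hF : aeval x F = 0) (hneg : ∀ r : ℝ, aeval r F = 0 → aeval r W.Ψ₂Sq < 0) :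
    GVPar W p :=
  ⟨Φ, hΦ, Or.inr ⟨lineUnramifiedAt_of_valuation_le_one_of_mult hΦ hp2 hmult hPΦ hP hx,
    lineOdd_of_forall_real_root_neg hΦ hp2 hPΦ hP0 hP hF hneg⟩⟩

/-- **Type A certificate (ramified ∧ odd)** (multiplicative odd `p`): `v_𝔓(x) > 1` and `Ψ₂Sq < 0` at
every real root of an `F` vanishing at `x` ⇒ `¬ GVPar W p`. [folklore] -/
theorem not_gvPar_of_one_lt_valuation_of_forall_real_root_neg_of_mult (hΦ : IsRationalLine W p Φ)
    (hp2 : p ≠ 2) (hmult : W.HasMultiplicativeReductionAtPrime p)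
    {P : geomTorsion W (p : ℤ)} (hPΦ : P ∈ Φ) (hP0 : P ≠ 0)
    {x y : AlgebraicClosure ℚ} {h : (W.baseChange (AlgebraicClosure ℚ)).toAffine.Nonsingular x y}
    (hP : (P : W.geomPoints) = Affine.Point.some x y h) (hx : 1 < (placeOver p).valuation x)
    {F : ℚ[X]} (hF : aeval x F = 0) (hneg : ∀ r : ℝ, aeval r F = 0 → aeval r W.Ψ₂Sq < 0) :
    ¬ GVPar W p := by
  refine not_gvPar_of_isRationalLine_of_hasMultiplicativeReduction hp2 hmult hΦ ?_
  have hram := (not_lineUnramifiedAt_iff_one_lt_valuation_of_mult hΦ hp2 hmult hPΦ hP).mpr hx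
  have hodd := lineOdd_of_forall_real_root_neg hΦ hp2 hPΦ hP0 hP hF hneg
  rintro (⟨-, he⟩ | ⟨hu, -⟩)
  · exact lineEven_lineOdd_false hp2 hΦ he hodd
  · exact hram hu

/-- **Type A certificate (unramified ∧ even)** (multiplicative odd `p`): `v_𝔓(x) ≤ 1` and `Ψ₂Sq > 0`
at every real root of an `F` vanishing at `x` ⇒ `¬ GVPar W p` — the shape of the KDISC-ODD rows of
type A on O9 (unramified ∧ even). [folklore] -/
theorem not_gvPar_of_valuation_le_one_of_forall_real_root_pos_of_mult (hΦ : IsRationalLine W p Φ)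
    (hp2 : p ≠ 2) (hmult : W.HasMultiplicativeReductionAtPrime p)
    {P : geomTorsion W (p : ℤ)} (hPΦ : P ∈ Φ) (hP0 : P ≠ 0)
    {x y : AlgebraicClosure ℚ} {h : (W.baseChange (AlgebraicClosure ℚ)).toAffine.Nonsingular x y}
    (hP : (P : W.geomPoints) = Affine.Point.some x y h) (hx : (placeOver p).valuation x ≤ 1)
    {F : ℚ[X]} (hF : aeval x F = 0) (hpos : ∀ r : ℝ, aeval r F = 0 → 0 < aeval r W.Ψ₂Sq) :
    ¬ GVPar W p := by
  refine not_gvPar_of_isRationalLine_of_hasMultiplicativeReduction hp2 hmult hΦ ?_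
  have hunr := lineUnramifiedAt_of_valuation_le_one_of_mult hΦ hp2 hmult hPΦ hP hx
  have heven := lineEven_of_forall_real_root_pos hΦ hp2 hPΦ hP0 hP hF hpos
  rintro (⟨hr, -⟩ | ⟨-, ho⟩)
  · exact hr hunr
  · exact lineEven_lineOdd_false hp2 hΦ heven ho

end Decision

end KernelDisc

end Summit.BirchSwinnertonDyer.Rank1Residual

end
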